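import Summits.RiemannHypothesis.RiemannHypothesis.Theorems.GroundBartaEvenWinsBeyondArchDeflationPanelQLoc4
import Summits.RiemannHypothesis.RiemannHypothesis.Theorems.GroundBartaEvenWinsBeyondArchDeflationPanelQLoc3Four
import HarnessLib

/-!
# RiemannHypothesis / GroundBarta — rung 4 (`EvenWinsBeyondArch`, stmt-RiemannHypothesis-18807 / 18085):
# the deflated Temple L-side beyond `(log 5)/2`, XIX b′ part 4 (four slots) — H-part literals, FOUR prime slots

Helper file (`--supports stmt-RiemannHypothesis-18807`), RH-free, no facts.  rh-explicit seat weil-5 (lead ruling R3-8a, 2026-08-22),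
four-slot twin of prover B's …DeflationPanelQLoc4 (`dt_panelQL_bulk4''`, `dt_panelQL_split4''`: the H-part as three proven-equal
literals).  Proofs = B's.
-/

set_option linter.dupNamespace false

noncomputable section

open MeasureTheory Set Filter intervalIntegral
open scoped Topology BigOperators

namespace Summit.RiemannHypothesis.RiemannHypothesis.Theorems.EvenWinsBeyondArch

open Literature.NumberTheory.LFunctions
open Literature.Analysis.ValidatedNumerics Literature.Analysis.ValidatedNumerics.PolyMP
  Literature.Analysis.ValidatedNumerics.NumericsMP Literature.Analysis.ValidatedNumerics.ExpPoly

section PanelQ4F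

variable {S : ℕ} {c : ℚ} {m Dl k : ℕ}

/-- **Bulk panel, fully chunked** (E, H-fold, H-near, H-far as literals). [cite: Bombieri2000Weil, Thm 2] -/
theorem dt_panelQL_bulk4'' (hS : 0 < S) (hc : 0 < c) (W : dt_WinL4 S c m Dl) (hh1 : 2 * (c / (2 * m)) ≤ 1)
    (gp : Fin k → Poly) (Mt : ℚ) (Wt : Fin k → Fin k → ℚ) (i : Fin k) (V : dt_VecL S c m Dl (gp i)) {j : ℕ}
    (hjm : j + 2 ≤ m) {K : ℕ} (hK : 0 < K) {Ke ke : ℕ} {f1 f2 f3 f4 : Bool × Bool}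
    (hchk : dt_bulkCheckL4 S c m Dl W (gp i) j Ke ke f1 f2 f3 f4 = true)
    (hRi : IntervalIntegrable (fun ρ ↦
      dt_windowResidual4 (c : ℝ) gp W.w1 W.L1 W.w2 W.L2 W.w3 W.L3 W.w4 W.L4 (Mt : ℝ) (fun a l ↦ (Wt a l : ℝ)) i
        (((PolyMP.panelCentre (c / (2 * m)) j : ℚ) : ℝ) + ρ) ^ 2) volume (-((c / (2 * m) : ℚ) : ℝ)) ((c / (2 * m) : ℚ) : ℝ))
    {Etm F N R : IPoly} (hE : dt_archETM S c m j Dl (dt_locI S (gp i) (ofRat S (PolyMP.panelCentre (c / (2 * m)) j))) W.M0 (ttruncI S (c / (2 * m)) Dl (dt_locI S (gp i) (ofRat S (PolyMP.panelCentre (c / (2 * m)) j)))) V.tabF W.muF (fun i ↦ (W.Dρ.getD i default).1) (fun i ↦ (W.Dρ.getD i default).2) = Etm)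
    (hF : dt_archHfoldTM S m j (ttruncI S (c / (2 * m)) Dl (dt_locI S (gp i) (ofRat S (PolyMP.panelCentre (c / (2 * m)) j)))) V.tabF W.muF = F) (hN : dt_archHnearTM S c m j Dl (ttruncI S (c / (2 * m)) Dl (dt_locI S (gp i) (ofRat S (PolyMP.panelCentre (c / (2 * m)) j)))) V.tabF W.muF (fun i ↦ (W.Dρ.getD i default).1) (fun i ↦ (W.Dρ.getD i default).2) = N)
    (hR : dt_archHfarTM S c m j Dl (ttruncI S (c / (2 * m)) Dl (dt_locI S (gp i) (ofRat S (PolyMP.panelCentre (c / (2 * m)) j)))) V.tabF W.muF (fun i ↦ (W.Dρ.getD i default).1) (fun i ↦ (W.Dρ.getD i default).2) = R) (p : Poly) :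
    ∫ ρ in (-((c / (2 * m) : ℚ) : ℝ))..((c / (2 * m) : ℚ) : ℝ),
        dt_windowResidual4 (c : ℝ) gp W.w1 W.L1 W.w2 W.L2 W.w3 W.L3 W.w4 W.L4 (Mt : ℝ) (fun a l ↦ (Wt a l : ℝ)) i
          (((PolyMP.panelCentre (c / (2 * m)) j : ℚ) : ℝ) + ρ) ^ 2 ≤
      ((sqIntegUpperQ S (c / (2 * m)) (dt_panelLTM4' S c m Dl K Ke ke W gp Mt Wt i V j f1 f2 f3 f4 Etm (taddI (tsubI F N) R)) p : ℚ) : ℝ) := by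
  subst hF; subst hN; subst hR
  rw [← dt_archHTM_split]
  exact dt_panelQL_bulk4' hS hc W hh1 gp Mt Wt i V hjm hK hchk hRi hE rfl p

/-- **Split panel, fully chunked.** [cite: Bombieri2000Weil, Thm 2] -/
theorem dt_panelQL_split4'' (hS : 0 < S) (hc : 0 < c) (W : dt_WinL4 S c m Dl) (hh1 : 2 * (c / (2 * m)) ≤ 1)
    (gp : Fin k → Poly) (Mt : ℚ) (Wt : Fin k → Fin k → ℚ) (i : Fin k) (V : dt_VecL S c m Dl (gp i)) {j : ℕ}
    (hjm : j + 2 ≤ m) {K : ℕ} (hK : 0 < K) {Ke ke : ℕ} (f1 f2 f3 f4 f1' f2' f3' f4' : Bool × Bool) {β : ℝ} {bm bp : ℚ}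
    (hchk : dt_splitCheckL S c m W.M0.length (gp i) j Ke ke bm bp = true) (hbmβ : (bm : ℝ) ≤ β) (hβbp : β ≤ bp)
    (hflA : ∀ ρ : ℝ, -((c / (2 * m) : ℚ) : ℝ) < ρ → ρ < β →
      (f1.1 = true ↔ (((PolyMP.panelCentre (c / (2 * m)) j : ℚ) : ℝ) + ρ) - W.L1 ∈ Icc (-(c : ℝ)) c) ∧
      (f1.2 = true ↔ (((PolyMP.panelCentre (c / (2 * m)) j : ℚ) : ℝ) + ρ) + W.L1 ∈ Icc (-(c : ℝ)) c) ∧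
      (f2.1 = true ↔ (((PolyMP.panelCentre (c / (2 * m)) j : ℚ) : ℝ) + ρ) - W.L2 ∈ Icc (-(c : ℝ)) c) ∧
      (f2.2 = true ↔ (((PolyMP.panelCentre (c / (2 * m)) j : ℚ) : ℝ) + ρ) + W.L2 ∈ Icc (-(c : ℝ)) c) ∧
      (f3.1 = true ↔ (((PolyMP.panelCentre (c / (2 * m)) j : ℚ) : ℝ) + ρ) - W.L3 ∈ Icc (-(c : ℝ)) c) ∧
      (f3.2 = true ↔ (((PolyMP.panelCentre (c / (2 * m)) j : ℚ) : ℝ) + ρ) + W.L3 ∈ Icc (-(c : ℝ)) c) ∧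
      (f4.1 = true ↔ (((PolyMP.panelCentre (c / (2 * m)) j : ℚ) : ℝ) + ρ) - W.L4 ∈ Icc (-(c : ℝ)) c) ∧
      (f4.2 = true ↔ (((PolyMP.panelCentre (c / (2 * m)) j : ℚ) : ℝ) + ρ) + W.L4 ∈ Icc (-(c : ℝ)) c))
    (hflB : ∀ ρ : ℝ, β < ρ → ρ < ((c / (2 * m) : ℚ) : ℝ) →
      (f1'.1 = true ↔ (((PolyMP.panelCentre (c / (2 * m)) j : ℚ) : ℝ) + ρ) - W.L1 ∈ Icc (-(c : ℝ)) c) ∧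
      (f1'.2 = true ↔ (((PolyMP.panelCentre (c / (2 * m)) j : ℚ) : ℝ) + ρ) + W.L1 ∈ Icc (-(c : ℝ)) c) ∧
      (f2'.1 = true ↔ (((PolyMP.panelCentre (c / (2 * m)) j : ℚ) : ℝ) + ρ) - W.L2 ∈ Icc (-(c : ℝ)) c) ∧
      (f2'.2 = true ↔ (((PolyMP.panelCentre (c / (2 * m)) j : ℚ) : ℝ) + ρ) + W.L2 ∈ Icc (-(c : ℝ)) c) ∧
      (f3'.1 = true ↔ (((PolyMP.panelCentre (c / (2 * m)) j : ℚ) : ℝ) + ρ) - W.L3 ∈ Icc (-(c : ℝ)) c) ∧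
      (f3'.2 = true ↔ (((PolyMP.panelCentre (c / (2 * m)) j : ℚ) : ℝ) + ρ) + W.L3 ∈ Icc (-(c : ℝ)) c) ∧
      (f4'.1 = true ↔ (((PolyMP.panelCentre (c / (2 * m)) j : ℚ) : ℝ) + ρ) - W.L4 ∈ Icc (-(c : ℝ)) c) ∧
      (f4'.2 = true ↔ (((PolyMP.panelCentre (c / (2 * m)) j : ℚ) : ℝ) + ρ) + W.L4 ∈ Icc (-(c : ℝ)) c))
    (hRi : IntervalIntegrable (fun ρ ↦
      dt_windowResidual4 (c : ℝ) gp W.w1 W.L1 W.w2 W.L2 W.w3 W.L3 W.w4 W.L4 (Mt : ℝ) (fun a l ↦ (Wt a l : ℝ)) i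
        (((PolyMP.panelCentre (c / (2 * m)) j : ℚ) : ℝ) + ρ) ^ 2) volume (-((c / (2 * m) : ℚ) : ℝ)) ((c / (2 * m) : ℚ) : ℝ))
    {Etm F N R : IPoly} (hE : dt_archETM S c m j Dl (dt_locI S (gp i) (ofRat S (PolyMP.panelCentre (c / (2 * m)) j))) W.M0 (ttruncI S (c / (2 * m)) Dl (dt_locI S (gp i) (ofRat S (PolyMP.panelCentre (c / (2 * m)) j)))) V.tabF W.muF (fun i ↦ (W.Dρ.getD i default).1) (fun i ↦ (W.Dρ.getD i default).2) = Etm)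
    (hF : dt_archHfoldTM S m j (ttruncI S (c / (2 * m)) Dl (dt_locI S (gp i) (ofRat S (PolyMP.panelCentre (c / (2 * m)) j)))) V.tabF W.muF = F) (hN : dt_archHnearTM S c m j Dl (ttruncI S (c / (2 * m)) Dl (dt_locI S (gp i) (ofRat S (PolyMP.panelCentre (c / (2 * m)) j)))) V.tabF W.muF (fun i ↦ (W.Dρ.getD i default).1) (fun i ↦ (W.Dρ.getD i default).2) = N)
    (hR : dt_archHfarTM S c m j Dl (ttruncI S (c / (2 * m)) Dl (dt_locI S (gp i) (ofRat S (PolyMP.panelCentre (c / (2 * m)) j)))) V.tabF W.muF (fun i ↦ (W.Dρ.getD i default).1) (fun i ↦ (W.Dρ.getD i default).2) = R) (pA pB : Poly) :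
    ∫ ρ in (-((c / (2 * m) : ℚ) : ℝ))..((c / (2 * m) : ℚ) : ℝ),
        dt_windowResidual4 (c : ℝ) gp W.w1 W.L1 W.w2 W.L2 W.w3 W.L3 W.w4 W.L4 (Mt : ℝ) (fun a l ↦ (Wt a l : ℝ)) i
          (((PolyMP.panelCentre (c / (2 * m)) j : ℚ) : ℝ) + ρ) ^ 2 ≤
      ((sqIntegSubLocQ S (c / (2 * m)) (dt_panelLTM4' S c m Dl K Ke ke W gp Mt Wt i V j f1 f2 f3 f4 Etm (taddI (tsubI F N) R)) pA
          (-(c / (2 * m))) bp : ℚ) : ℝ) +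
        ((sqIntegSubLocQ S (c / (2 * m)) (dt_panelLTM4' S c m Dl K Ke ke W gp Mt Wt i V j f1' f2' f3' f4' Etm (taddI (tsubI F N) R)) pB
          bm (c / (2 * m)) : ℚ) : ℝ) := by
  subst hF; subst hN; subst hR
  rw [← dt_archHTM_split]
  exact dt_panelQL_split4' hS hc W hh1 gp Mt Wt i V hjm hK f1 f2 f3 f4 f1' f2' f3' f4' hchk hbmβ hβbp hflA hflB hRi hE rfl pA pB

end PanelQ4F

end Summit.RiemannHypothesis.RiemannHypothesis.Theorems.EvenWinsBeyondArch

end
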